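import Literature.Computability.Complexity.ACRealizeOver
import Literature.Computability.Complexity.ACRealizeVec
import HarnessLib

/-!
# Gate lists with depth AND wire bookkeeping (line `Sketch`, crux `CircuitNpTc0`, stmt-PneNP-0039)

Generic helper file for the stub `stub_selfReduction` of the line `Sketch` of the crux
`CircuitNpTc0 = ¬ (NP ⊆ TC⁰)` (`--supports`; closes nothing by itself). The line measures sparse
threshold circuits by their number of WIRES (the sum of the arities of the gates,
`Theorems/CircuitCircuitNpTc0Defs.lean`, `wires`), whereas the tree's compositional calculus
`ACVecOver B f d s` (`Literature/…/ACVecOver.lean`) tracks depth and SIZE (number of gates). This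
file is the wires-analogue:

* `WVec Bs d w` — the set of multi-output maps `f : (ι → Bool) → (κ → Bool)` carried by the output
  wires, each of `acWeight`-depth `≤ d`, of ONE well-formed gate list over the basis `Bs` with at
  most `w` wires;
* `WVec.comp` — composition with sharing: depths add, wires add (a relocated gate list has the
  same arities; the relocation lemmas `GateList.vals_append_reloc`,
  `GateList.wdepths_append_reloc_le` of the tree);
* `wvec_ofBlocks`, `wvec_ofBlocks_fintype` — juxtaposition of single-output blocks
  (`GateList.parBlocks`): wires add, common depth bound;
* `wvec_circuit` (a relocated copy of a `Circuit` with re-wired inputs: same depth and wires),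
  `wvec_gate` (one gate of the basis on input wires: depth `1`, `arity` wires), `wvec_reindex`,
  `WVec.toCircuit` (extraction of a `Circuit` with `IsOver`, `acDepth`, wires and semantics).

Everything is proved (Vollmer 1999, §1.2: composition of circuits); Mathlib has no Boolean circuits.
-/

-- `Summit.<Summit>.<Problem>`: for the single-conjunct summit `PneNP` the duplicate `PneNP.PneNP` is mandated (D-0017).
set_option linter.dupNamespace false

namespace Summit.PneNP.PneNP.Cruxes.CircuitNpTc0.Sketch

open Literature.Computability.Complexity GateList Finset

variable {ι ι' κ κ' μ : Type*}

/-- `WVec Bs d w`: the set of multi-output Boolean maps `f` for which some well-formed gate list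
over the basis `Bs` with at most `w` wires (sum of the arities of its gates) has output wires
`o k`, each of `acWeight`-depth `≤ d`, carrying `f x k` (the wires-analogue of `ACVecOver`;
Vollmer 1999, §1.2). [folklore] -/
def WVec (Bs : Set GateFn) (d w : ℕ) : Set ((ι → Bool) → κ → Bool) :=
  {f | ∃ (gs : List (Gate ι)) (o : κ → ι ⊕ ℕ), WF gs ∧ (∀ g ∈ gs, g.fn ∈ Bs) ∧
    (∀ k, OutOK gs.length (o k)) ∧ (gs.map Gate.arity).sum ≤ w ∧
      (∀ k, wireDepthOf (wdepths acWeight gs) (o k) ≤ d) ∧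
        ∀ x k, wireOf x (vals gs x) (o k) = f x k}

/-- Relocation keeps the arity of a gate. [folklore] -/
@[simp] theorem arity_reloc (ρ : ι' → ι ⊕ ℕ) (L : ℕ) (g : Gate ι') :
    (reloc ρ L g).arity = g.arity := rfl

/-- Relocation keeps the number of wires of a gate list. [folklore] -/
theorem wires_map_reloc (ρ : ι' → ι ⊕ ℕ) (L : ℕ) (gs : List (Gate ι')) :
    ((gs.map (reloc ρ L)).map Gate.arity).sum = (gs.map Gate.arity).sum := by
  simp [List.map_map, Function.comp_def]

/-- The wires of juxtaposed blocks add up. [folklore] -/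
theorem wires_parBlocks : ∀ bs : List (List (Gate ι) × (ι ⊕ ℕ)),
    ((parBlocks bs).1.map Gate.arity).sum = (bs.map fun b => (b.1.map Gate.arity).sum).sum
  | [] => rfl
  | (gs, o) :: rest => by
    simp only [parBlocks, List.map_append, List.sum_append, List.map_cons, List.sum_cons,
      List.map_map, Function.comp_def, arity_reloc]
    rw [← wires_parBlocks rest]

namespace WVec

variable {Bs : Set GateFn} {f g : (ι → Bool) → κ → Bool} {d d' w w' : ℕ}

/-- Monotonicity in depth and wires. [folklore] -/
theorem mono (h : f ∈ WVec Bs d w) (hd : d ≤ d') (hw : w ≤ w') : f ∈ WVec Bs d' w' := by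
  obtain ⟨gs, o, hwf, hb, ho, hl, hdep, hev⟩ := h
  exact ⟨gs, o, hwf, hb, ho, hl.trans hw, fun k => (hdep k).trans hd, hev⟩

/-- Extensionality in the computed map. [folklore] -/
theorem congr (h : f ∈ WVec Bs d w) (hfg : ∀ x k, f x k = g x k) : g ∈ WVec Bs d w := by
  obtain ⟨gs, o, hwf, hb, ho, hl, hdep, hev⟩ := h
  exact ⟨gs, o, hwf, hb, ho, hl, hdep, fun x k => (hev x k).trans (hfg x k)⟩

/-- Selecting / reindexing output wires is free. [folklore] -/
theorem outMap (h : f ∈ WVec Bs d w) (r : κ' → κ) : (fun x k' => f x (r k')) ∈ WVec Bs d w := by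
  obtain ⟨gs, o, hwf, hb, ho, hl, hdep, hev⟩ := h
  exact ⟨gs, fun k' => o (r k'), hwf, hb, fun k' => ho _, hl, fun k' => hdep _, fun x k' => hev x _⟩

/-- **Composition with sharing** (Vollmer 1999, §1.2): depths add and wires add — the program of
`f` is laid down once and the program of `F` is relocated behind it (`GateList.reloc` keeps
arities), its input `k` re-wired to the `k`-th output wire of `f`. [folklore] -/
theorem comp {F : (κ → Bool) → μ → Bool} {d₁ w₁ : ℕ} (hF : F ∈ WVec Bs d₁ w₁)
    {f : (ι → Bool) → κ → Bool} {d w : ℕ} (hf : f ∈ WVec Bs d w) :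
    (fun x => F (f x)) ∈ WVec Bs (d₁ + d) (w₁ + w) := by
  obtain ⟨gsF, oF, hwfF, hBF, hoF, hlF, hdepF, hevF⟩ := hF
  obtain ⟨G, ρ, hwfG, hBG, hρ', hlG, hdepG, hevG⟩ := hf
  have hρ : WiresOK G.length ρ := fun j m hm => hρ' j m hm
  obtain ⟨ds', hds', _, hle'⟩ := wdepths_append_reloc_le acWeight G gsF ρ hρ d hdepG
  refine ⟨G ++ gsF.map (reloc ρ G.length), fun k => shiftWire ρ G.length (oF k),
    hwfG.append_reloc hwfF hρ, ?_, fun k => ?_, ?_, fun k => ?_, fun x k => ?_⟩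
  · intro g' hg'
    rw [List.mem_append, List.mem_map] at hg'
    rcases hg' with hg' | ⟨g₀, hg₀, rfl⟩
    · exact hBG g' hg'
    · rw [reloc_fn]; exact hBF g₀ hg₀
  · rw [List.length_append, List.length_map]
    exact wiresOK_shiftWire hρ (fun k m hm => hoF k m hm) k
  · rw [List.map_append, List.sum_append, wires_map_reloc, add_comm]
    exact Nat.add_le_add hlF hlG
  · rw [hds']
    have hρd : WiresOK (wdepths acWeight G).length ρ := by rw [length_wdepths]; exact hρ
    have := wireDepthOf_shiftWire_le (ds := wdepths acWeight G) ρ hρd hdepG hle' (oF k) (hdepF k)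
    rw [length_wdepths] at this
    exact this
  · show wireOf x (vals (G ++ gsF.map (reloc ρ G.length)) x) (shiftWire ρ G.length (oF k)) = _
    rw [vals_append_reloc G gsF ρ hρ x,
      wireOf_shiftWire x (vals G x) _ (length_vals G x) ρ hρ (oF k)]
    have hx : (fun i => wireOf x (vals G x) (ρ i)) = f x := funext (hevG x)
    rw [hx]
    exact hevF _ k

/-- **Extraction of a circuit** with the recorded basis, depth, wires and semantics. [folklore] -/
theorem toCircuit {f : (ι → Bool) → Bool} (h : (fun x (_ : Unit) => f x) ∈ WVec Bs d w) :
    ∃ C : Circuit ι, C.IsOver Bs ∧ C.acDepth ≤ d ∧ (C.gates.map Gate.arity).sum ≤ w ∧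
      ∀ x, C.eval x = f x := by
  obtain ⟨gs, o, hwf, hb, ho, hl, hdep, hev⟩ := h
  refine ⟨GateList.toCircuit gs (o ()) hwf (ho ()), hb, ?_, hl, fun x => ?_⟩
  · change Circuit.depthWith _ acWeight ≤ d
    rw [circuit_depthWith]
    exact hdep ()
  · rw [circuit_eval]
    exact hev x ()

end WVec

/-- The re-indexing layer `y ↦ (y (e i))ᵢ` costs nothing: no gate, depth `0`. [folklore] -/
theorem wvec_reindex (Bs : Set GateFn) (e : ι → ι') :
    (fun (y : ι' → Bool) i => y (e i)) ∈ WVec Bs 0 0 :=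
  ⟨[], fun i => Sum.inl (e i), WF.nil, (by simp), (fun _ _ h => by cases h), (by simp),
    (fun _ => by simp), fun _ _ => rfl⟩

/-- A circuit over `Bs` realizes its own function with its own depth and wires. [folklore] -/
theorem wvec_of_circuit {Bs : Set GateFn} (C : Circuit ι) (hB : C.IsOver Bs) :
    (fun x (_ : Unit) => C.eval x) ∈ WVec Bs C.acDepth (C.gates.map Gate.arity).sum := by
  refine ⟨C.gates, fun _ => C.output, wf_gates C, hB, fun _ => C.wf_output, le_rfl, fun _ => ?_,
    fun x _ => ?_⟩
  · have h := circuit_depthWith C acWeight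
    change C.acDepth = _ at h
    rw [← h]
  · beta_reduce
    rw [circuit_eval]

/-- **A relocated copy of a circuit** with its inputs re-wired along `e`: same depth, same
wires. [folklore] -/
theorem wvec_circuit {Bs : Set GateFn} (C : Circuit ι') (hB : C.IsOver Bs) (e : ι' → ι) :
    (fun (y : ι → Bool) (_ : Unit) => C.eval fun q => y (e q)) ∈ WVec Bs C.acDepth
      (C.gates.map Gate.arity).sum := by
  simpa using WVec.comp (wvec_of_circuit C hB) (wvec_reindex Bs e)

/-- **One gate of the basis** reading input wires: depth `1`, `arity` wires. [folklore] -/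
theorem wvec_gate {Bs : Set GateFn} (g : GateFn) (hg : g ∈ Bs) (w : Fin g.1 → ι) :
    (fun (y : ι → Bool) (_ : Unit) => g.2 fun a => y (w a)) ∈ WVec Bs 1 g.1 := by
  obtain ⟨k, op⟩ := g
  refine ⟨[⟨k, op, fun a => .inl (w a)⟩], fun _ => .inr 0, ?_, ?_, ?_, ?_, ?_, fun x _ => ?_⟩
  · exact WF.singleton fun a m h => by cases h
  · intro g' hg'
    rw [List.mem_singleton] at hg'
    subst hg'
    exact hg
  · intro _ m hm
    simp only [Sum.inr.injEq] at hm
    subst hm; simp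
  · simp
  · intro _
    simp only [wireDepthOf_inr]
    rw [getD_wdepths_singleton]
    have h0 : (univ.sup fun a : Fin k => wireDepthOf ([] : List ℕ) ((Sum.inl (w a) : ι ⊕ ℕ))) = 0 :=
      Nat.eq_zero_of_le_zero (Finset.sup_le fun _ _ => le_rfl)
    exact Nat.add_le_add (acWeight_le_one _) h0.le
  · simp [vals]

/-- **Juxtaposition of blocks** (Vollmer 1999, §1.2): wires add, the depth is the common depth
bound of the blocks (the blocks are laid side by side, `GateList.parBlocks`). [folklore] -/
theorem wvec_ofBlocks {Bs : Set GateFn} {M : ℕ} {f : Fin M → (ι → Bool) → Bool} {d : ℕ}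
    {w : Fin M → ℕ} (h : ∀ j, (fun x (_ : Unit) => f j x) ∈ WVec Bs d (w j)) :
    (fun x j => f j x) ∈ WVec Bs d (∑ j, w j) := by
  choose gs o hwf hB ho hl hdep hev using h
  set bs : List (List (Gate ι) × (ι ⊕ ℕ)) := List.ofFn fun j => (gs j, o j ()) with hbs
  have hbs_len : bs.length = M := by simp [hbs]
  have hmem : ∀ b ∈ bs, ∃ j, b = (gs j, o j ()) := by
    intro b hb
    simp only [hbs, List.mem_ofFn] at hb
    obtain ⟨j, rfl⟩ := hb
    exact ⟨j, rfl⟩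
  have hO : ∀ b ∈ bs, OutOK b.1.length b.2 := by
    intro b hb; obtain ⟨j, rfl⟩ := hmem b hb; exact ho j ()
  have houts_len : (parBlocks bs).2.length = M := by rw [length_parBlocks_snd, hbs_len]
  have hbsk : ∀ j : Fin M, bs[j.1]'(by rw [hbs_len]; exact j.2) = (gs j, o j ()) := by
    intro j; simp [hbs]
  refine ⟨(parBlocks bs).1, fun j => (parBlocks bs).2[j.1]'(by rw [houts_len]; exact j.2),
    wf_parBlocks bs fun b hb => ?_, fn_mem_parBlocks bs fun b hb => ?_, fun j => ?_, ?_,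
    fun j => ?_, fun x j => ?_⟩
  · obtain ⟨j, rfl⟩ := hmem b hb; exact hwf j
  · obtain ⟨j, rfl⟩ := hmem b hb; exact hB j
  · exact outOK_parBlocks bs hO _ (List.getElem_mem _)
  · rw [wires_parBlocks]
    simp only [hbs, List.map_ofFn, List.sum_ofFn, Function.comp_def]
    exact Finset.sum_le_sum fun j _ => hl j
  · have := wireDepthOf_parBlocks acWeight bs hO j.1 (by rw [houts_len]; exact j.2)
      (by rw [hbs_len]; exact j.2)
    rw [hbsk j] at this
    rw [this]
    exact hdep j ()
  · have := wireOf_parBlocks x bs hO j.1 (by rw [houts_len]; exact j.2)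
      (by rw [hbs_len]; exact j.2)
    rw [hbsk j] at this
    rw [this]
    exact hev j x ()

/-- Juxtaposition of blocks indexed by a finite type (through an enumeration). [folklore] -/
theorem wvec_ofBlocks_fintype {Bs : Set GateFn} [Fintype κ] {f : κ → (ι → Bool) → Bool}
    {d : ℕ} {w : κ → ℕ} (h : ∀ k, (fun x (_ : Unit) => f k x) ∈ WVec Bs d (w k)) :
    (fun x k => f k x) ∈ WVec Bs d (∑ k, w k) := by
  set e := Fintype.equivFin κ
  have hv := wvec_ofBlocks fun j : Fin (Fintype.card κ) => h (e.symm j)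
  rw [show (∑ j, w (e.symm j)) = ∑ k, w k from Equiv.sum_comp e.symm w] at hv
  exact WVec.congr (WVec.outMap hv e) fun x k => by simp

end Summit.PneNP.PneNP.Cruxes.CircuitNpTc0.Sketch
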